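import Mathlib
import Summits.Ventures.HodgeRepro2.T6A1Complex
import Summits.Ventures.HodgeRepro2.A1EigenlineDimension

/-!
# T6A1ComplexWeil — the complex Weil summand and Lemma A1.3 over `ℂ` on the interface

Tier-6 sub-goal A1 (route/T6-A1-t6-p1.md §1 (A1.ii)–(A1.iii); TARGET-T6.md §2 Layer II). Continuation of
`T6A1Complex`: each eigenline `eigenLineK K σ` is a `ℂ`-line (`exists_eigenLineK_eq_span`, p7's
`A1EigenlineDimension`); the complex Weil summand `W_ℂ = ⊕_σ ⋀⁴ V_σ` (`weilSummandC`) is the range of the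
complex Weil projector `e_ℂ` on `H⁴(B, ℂ)` (`map_eC_degBC`); the complexification `extC` of `H⁴(B, ℚ)`
spans `H⁴(B, ℂ)` (`span_extC_degB`); and therefore the `ℂ`-span of the complexified rational Weil line
`weilQ K` IS `W_ℂ` (`span_extC_weilQ`) — TIER4 Lemma A1.3 / Prop. A2.3(iv) read over `ℂ`, with no descent:
`e_ℂ ∘ extC = extC ∘ p_W` and `weilQ K = p_W(H⁴(B, ℚ))`.
-/

namespace Summit.Ventures.HodgeRepro2.T6.A1ComplexWeil

open Polynomial A1WeilProjector A1ProjData A1Monomials A2Model A1Complex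
open scoped TensorProduct

variable (K : Type*) [Field K] [NumberField K]

/-! ## 1. Each eigenline is a `ℂ`-line (TIER4 (A0.4): «each `ℓ_{i,σ}` has dimension exactly 1») -/

/-- `dim_ℂ (eigenLineK K σ) = 1` (p7's `A1EigenlineDimension.finrank_eigenline` at `V = K`). -/
theorem finrank_eigenLineK (σ : K →+* ℂ) : Module.finrank ℂ (eigenLineK K σ) = 1 := by
  classical
  rw [eigenLineK_eq]
  have hcard : Fintype.card (K →ₐ[ℚ] ℂ) = Module.finrank ℚ K := AlgHom.card ℚ K ℂ
  rw [A1EigenlineDimension.finrank_eigenline ℚ ℂ K K hcard σ.toRatAlgHom]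
  exact Module.finrank_self K

/-- Each eigenline of `K ⊗ ℂ` is spanned by a non-zero vector. -/
theorem exists_eigenLineK_eq_span (σ : K →+* ℂ) :
    ∃ v : KC K, v ≠ 0 ∧ eigenLineK K σ = Submodule.span ℂ {v} := by
  obtain ⟨v, hv0, hv⟩ := finrank_eq_one_iff'.1 (finrank_eigenLineK K σ)
  refine ⟨(v : KC K), fun h => hv0 (Submodule.coe_eq_zero.1 h), ?_⟩
  ext w
  rw [Submodule.mem_span_singleton]
  constructor
  · intro hw
    obtain ⟨c, hc⟩ := hv ⟨w, hw⟩
    exact ⟨c, congrArg Subtype.val hc⟩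
  · rintro ⟨c, rfl⟩
    exact Submodule.smul_mem _ c v.2

/-! ## 2. The complex Weil summand `⊕_σ ⋀⁴ V_σ` and the range of `e_ℂ` -/

variable [IsGalois ℚ K] [DecidableEq (K →+* ℂ)] [DecidableEq (K →ₐ[ℚ] K)] [DecidableEq K]

/-- The complex Weil summand `W_ℂ = ⊕_σ ⋀⁴ V_σ ⊆ ⋀⁴ H¹(B, ℂ)` (TIER4 Def. A1.1). -/
noncomputable def weilSummandC : Submodule ℂ (⋀[ℂ]^4 (H1C K)) :=
  ⨆ ρ : K →+* ℂ, piece (eigenSpace K) 4 fun ρ' => (weilIdxC K 4 ρ ρ' : ℕ)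

/-- The complex Weil summand inside `H^*(B, ℂ)`. -/
noncomputable def weilSummandC' : Submodule ℂ (HBC K) :=
  (weilSummandC K).map (⋀[ℂ]^4 (H1C K)).subtype

variable (P : WeilProjData K 4)

/-- `e_ℂ` is the identity on `W_ℂ`. -/
theorem eC_coe_of_mem_weilSummandC {v : ⋀[ℂ]^4 (H1C K)} (hv : v ∈ weilSummandC K) :
    eC K P (v : HBC K) = v := by
  refine Submodule.iSup_induction (motive := fun w : ⋀[ℂ]^4 (H1C K) => eC K P (w : HBC K) = w) _ hv
    (fun ρ v hv => ?_) (by simp) (fun v w hv hw => by rw [Submodule.coe_add, map_add, hv, hw])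
  rw [eC_coe_of_mem_piece K P (weilIdxC K 4 ρ) hv, if_pos ⟨ρ, rfl⟩, one_smul]

/-- `e_ℂ` takes `H⁴(B, ℂ)` into `W_ℂ`. -/
theorem eC_coe_mem (v : ⋀[ℂ]^4 (H1C K)) : eC K P (v : HBC K) ∈ weilSummandC' K := by
  have hv : v ∈ ⨆ k : (K →+* ℂ) → Fin 5, piece (eigenSpace K) 4 fun ρ => (k ρ : ℕ) := by
    rw [(eigenDataC K P.x P.sep).iSup_eq_top]
    exact Submodule.mem_top
  refine Submodule.iSup_induction
    (motive := fun w : ⋀[ℂ]^4 (H1C K) => eC K P (w : HBC K) ∈ weilSummandC' K) _ hv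
    (fun k v hv => ?_) (by simp) (fun v w hv hw => by rw [Submodule.coe_add, map_add]; exact add_mem hv hw)
  rw [eC_coe_of_mem_piece K P k hv]
  split_ifs with h
  · obtain ⟨ρ, rfl⟩ := h
    rw [one_smul]
    exact ⟨v, Submodule.mem_iSup_of_mem ρ hv, rfl⟩
  · rw [zero_smul]
    exact zero_mem _

/-- The range of `e_ℂ` on `H⁴(B, ℂ)` is the complex Weil summand (TIER4 Prop. A2.3(i)). -/
theorem map_eC_degBC : (degBC K 4).map (eC K P) = weilSummandC' K := by
  apply le_antisymm
  · rintro _ ⟨v, hv, rfl⟩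
    exact eC_coe_mem K P ⟨v, hv⟩
  · rintro _ ⟨v, hv, rfl⟩
    exact ⟨v, v.2, eC_coe_of_mem_weilSummandC K P hv⟩

/-! ## 3. The complexification of `H⁴(B, ℚ)` spans `H⁴(B, ℂ)` -/

omit [IsGalois ℚ K] [DecidableEq (K →+* ℂ)] [DecidableEq (K →ₐ[ℚ] K)] [DecidableEq K] in
/-- `h1ToC` componentwise. -/
theorem h1ToC_apply (v : H1 K) (i : Fin 4) : h1ToC K v i = (1 : ℂ) ⊗ₜ[ℚ] v i := rfl

omit [IsGalois ℚ K] [DecidableEq (K →+* ℂ)] [DecidableEq (K →ₐ[ℚ] K)] [DecidableEq K] in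
/-- `H¹(B, ℂ)` is spanned over `ℂ` by the complexified rational vectors. -/
theorem span_range_h1ToC : Submodule.span ℂ (Set.range (h1ToC K)) = ⊤ := by
  classical
  rw [eq_top_iff]
  intro w _
  have key : ∀ (i : Fin 4) (z : KC K), Pi.single i z ∈ Submodule.span ℂ (Set.range (h1ToC K)) := by
    intro i z
    induction z using TensorProduct.induction_on with
    | zero => rw [Pi.single_zero]; exact zero_mem _
    | tmul c k =>
      have h : Pi.single i (c ⊗ₜ[ℚ] k) = c • h1ToC K (Pi.single i k) := by
        funext j
        by_cases hj : j = i
        · subst hj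
          simp [h1ToC_apply, TensorProduct.smul_tmul']
        · simp [hj, h1ToC_apply]
      rw [h]
      exact Submodule.smul_mem _ c (Submodule.subset_span ⟨_, rfl⟩)
    | add a b ha hb => rw [Pi.single_add]; exact add_mem ha hb
  rw [← Finset.univ_sum_single w]
  exact Submodule.sum_mem _ fun i _ => key i (w i)

omit [IsGalois ℚ K] [DecidableEq (K →+* ℂ)] [DecidableEq (K →ₐ[ℚ] K)] [DecidableEq K] in
/-- `extC` on a wedge monomial. -/
theorem extC_ιMulti_eq (w : Fin 4 → H1 K) :
    extC K (ExteriorAlgebra.ιMulti ℚ 4 w) = ExteriorAlgebra.ιMulti ℂ 4 (h1ToC K ∘ w) := by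
  rw [ExteriorAlgebra.ιMulti_apply, ExteriorAlgebra.ιMulti_apply, map_list_prod, List.map_ofFn]
  congr 1
  exact congrArg List.ofFn (funext fun i => by simp only [Function.comp_apply, extC_ι])

omit [IsGalois ℚ K] [DecidableEq (K →+* ℂ)] [DecidableEq (K →ₐ[ℚ] K)] [DecidableEq K] in
/-- `H⁴(B, ℂ) = ℂ · extC (H⁴(B, ℚ))` (TIER4 (A0.3)(ii): `H^n(B, ℚ) ⊗ ℂ = H^n(B, ℂ)`). -/
theorem span_extC_degB : Submodule.span ℂ (extC K '' (degB K 4 : Set (HB K))) = degBC K 4 := by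
  apply le_antisymm
  · rw [Submodule.span_le]
    rintro _ ⟨a, ha, rfl⟩
    change a ∈ ⋀[ℚ]^4 (H1 K) at ha
    rw [← exteriorPower.ιMulti_span_fixedDegree ℚ 4 (H1 K)] at ha
    induction ha using Submodule.span_induction with
    | mem a ha =>
      obtain ⟨w, rfl⟩ := ha
      rw [extC_ιMulti_eq, ← exteriorPower.ιMulti_apply_coe]
      exact Submodule.coe_mem _
    | zero => rw [map_zero]; exact zero_mem _
    | add a b _ _ ha hb => rw [map_add]; exact add_mem ha hb
    | smul q a _ ha => rw [map_smul]; exact Submodule.smul_of_tower_mem _ q ha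
  · have h := exteriorPower.ιMulti_span_of_span ℂ 4 (H1C K) (span_range_h1ToC K)
    change (⋀[ℂ]^4 (H1C K)) ≤ _
    rw [← Submodule.range_subtype (⋀[ℂ]^4 (H1C K)), ← Submodule.map_top, ← h, Submodule.map_span,
      Submodule.span_le]
    rintro _ ⟨_, ⟨a, ha, rfl⟩, rfl⟩
    have hw : ∀ i, ∃ v : H1 K, h1ToC K v = a i := fun i => ha ⟨i, rfl⟩
    choose w hw using hw
    have : a = h1ToC K ∘ w := by funext i; exact (hw i).symm
    refine Submodule.subset_span ⟨ExteriorAlgebra.ιMulti ℚ 4 w, ?_, ?_⟩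
    · rw [← exteriorPower.ιMulti_apply_coe]
      exact Submodule.coe_mem _
    · rw [extC_ιMulti_eq, Submodule.subtype_apply, exteriorPower.ιMulti_apply_coe, this]

/-! ## 4. Lemma A1.3 over `ℂ`: the `ℂ`-span of the complexified Weil line is `W_ℂ` -/

omit [DecidableEq (K →+* ℂ)] in
/-- `weilQ K` is the image of `H⁴(B, ℚ)` under `p_W` (`weilLine = range p_W`, `T6A1ProjData`). -/
theorem weilQ_eq_image : (weilQ K : Set (HB K)) = pW K P '' (degB K 4 : Set (HB K)) := by
  have hW := P.weilLine_eq_range_proj (H1 K) (Module.finrank_fin_fun K)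
  ext a
  constructor
  · rintro ⟨v, hv, rfl⟩
    change v ∈ weilLine (K := K) 4 (H1 K) at hv
    rw [hW] at hv
    obtain ⟨u, rfl⟩ := hv
    exact ⟨u, u.2, by rw [Submodule.subtype_apply]; exact pW_coe K P u⟩
  · rintro ⟨a, ha, rfl⟩
    refine ⟨P.proj (H1 K) ⟨a, ha⟩, ?_, by rw [Submodule.subtype_apply]; exact (pW_coe K P ⟨a, ha⟩).symm⟩
    change _ ∈ weilLine (K := K) 4 (H1 K)
    rw [hW]
    exact ⟨⟨a, ha⟩, rfl⟩

/-- LEMMA A1.3 over `ℂ` (TIER4 Prop. A2.3(iv), `W_F(B) ⊗ ℂ = W_ℂ`): the `ℂ`-span of the complexified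
rational Weil line is the complex Weil summand `⊕_σ ⋀⁴ V_σ`. -/
theorem span_extC_weilQ :
    Submodule.span ℂ (extC K '' (weilQ K : Set (HB K))) = weilSummandC' K := by
  obtain ⟨P⟩ := exists_weilProjData K 4
  rw [weilQ_eq_image K P, Set.image_image]
  have h : (fun a => extC K (pW K P a)) = fun a => eC K P (extC K a) :=
    funext fun a => (eC_extC K P a).symm
  rw [h, show ((fun a => eC K P (extC K a)) '' (degB K 4 : Set (HB K))) =
      eC K P '' (extC K '' (degB K 4 : Set (HB K))) from (Set.image_image _ _ _).symm,
    Submodule.span_image, span_extC_degB, map_eC_degBC]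

end Summit.Ventures.HodgeRepro2.T6.A1ComplexWeil
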